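import Literature.NumberTheory.Rogawski1990.UnitFundamentalLemmaInertFlickerFrame     -- ★ (F0) «ONE-PLACE MODEL»: `isLocalNormPair_iff_isConj_endoGL_conj`, `mem_cmLocalIntegralLevel_iff_conj_mem_glInt`, `exists_frame_of_nonsplit` (inert)
import HarnessLib

/-!
# The one-place frame of `G′_v = U(H′)(L⁺_v)` from ANY integral similitude `ᵗσ̄T · Φ₃ · T = a · H′_w` — non-split place, ramified allowed
(Rogawski 1990 §14.2 p. 233, §4.9 p. 54; Flicker 1998 §2; Platonov–Rapinchuk §2.3, §5.1)

Topic `NumberTheory/Rogawski1990`; namespace `Literature.NumberTheory.Rogawski1990`.  KERNEL mathematics only: theorems, no definition, no named fact, no instance,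
no notation, no `sorry`.  Cell `pub/hodgecm-mathlib`, road «S3-res» ∕ LEAD T11-41 «S3-ram» seeding wave (owner F0P3a-p06 (g15)), row **«P-1-ram (i) LITERALS∕FRAME», CUT (F)
«FRAME»** (LEAD T11-60 (4); seat F0P3a-p04 (g17); consumer: A-p16 (g31)'s «P-1-ram» skeleton STUB A binders `(A hA hframe)`).  HONEST LABEL: HC_CM is proved only modulo the
2 remaining named inputs (hLiu418 24832, h413 24833) until rung 0 closes; this file discharges no named fact and has no books consequence (Literature seeding, `--supports 24833`).

THE MATHEMATICS.  In ★ `exists_frame_of_nonsplit` (inert, good reduction) the hypotheses «`v` unramified in `L`», «`H′_w ∈ GL₃(𝒪_w)`» serve ONE purpose: to produce an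
integral hyperbolic basis `T ∈ GL₃(𝒪_w)`, `ᵗσ̄T Φ₃ T = H′_w` (★ integral Jacobowitz `exists_glInt_placeForm_eq_formCongr_antidiagonal_of_isUnramifiedIn`).  Everything after
that is place-generic: ★ `localNonsplitCongr` transports along `ᵗσ̄T Φ₃ T = a · H′_w` for ANY unit scalar `a ∈ L_w^×` (★ `unitaryGroupOfForm_smul_of_isUnit`: `U(a·J) = U(J)`),
★ `localNonsplitEquiv` is the one-place model, ★ `mem_cmLocalIntegralLevel_iff_conj_mem_glInt` needs `T ∈ GL₃(𝒪_w)` only, ★ `isLocalNormPair_iff_isConj_endoGL_conj` holds for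
any `T`.  Hence:
* §1 `exists_frame_of_formCongr_smul`: for a non-split `w`, `T ∈ GL₃(𝒪_w)` and a unit `a` with `ᵗσ̄T Φ₃,w T = a · H′_w` there is `e : G′_v ≃ₜ* U(σ_w, Φ₃)(L_w)` with
  (i) `e g = T g_w T⁻¹`, (ii) `g ∈ K′ ⟺ e g ∈ GL₃(𝒪_w)`, (iii) `ι_v(γ_H) ↔ b ⟺ ι((γ_H)_w) ∼ e b` in `GL₃(L_w)` — ★ `exists_frame_of_nonsplit`'s conclusion VERBATIM for the GIVEN `T`.
* §2 `exists_frame_of_eq_smul_formCongr_antidiagonal`: the same from the «S3-ram» fold's socket binders VERBATIM — `hH′w : IsUnit (placeForm H′ w.1)`, `A ∈ GL₃(𝒪_w)`,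
  `hframe : H′_w = (−det H′_w) • ᵗσ̄A Φ₃ A` (the ramified self-dual frame ★ `exists_glInt_placeForm_eq_smul_formCongr_antidiagonal_of_neg`, p846344) — with `T := A`,
  `a := (−det H′_w)⁻¹`.  No `hv`, no `he`: valid at every non-split place; at a tame-ramified `w` it is the frame of census item (i) of the «P-1-ram» clause.

## References
* [Rogawski1990] J. D. Rogawski, *Automorphic Representations of Unitary Groups in Three Variables*, Ann. of Math. Stud. 123 (1990), §14.2 p. 233 («`K_v ≃ K′_v`»), §4.9 p. 54, §3.1 p. 19.
* [Flicker1998UnitaryFL] Y. Z. Flicker, *Elementary proof of the fundamental lemma for a unitary group*, Canad. J. Math. 50 (1998), §2 pp. 77–79.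
* [PlatonovRapinchuk1994] V. Platonov, A. Rapinchuk, *Algebraic Groups and Number Theory* (1994), §2.3, §5.1.
* [Jacobowitz1962] R. Jacobowitz, *Hermitian forms over local fields*, Amer. J. Math. 84 (1962), §7.
-/

set_option autoImplicit false

noncomputable section

open NumberField IsDedekindDomain Matrix Topology
open scoped Matrix MatrixGroups

namespace Literature.NumberTheory.Rogawski1990

open Literature.NumberTheory.Automorphic Literature.NumberTheory.Automorphic.UnitaryGroup

variable (L : Type) [Field L] [NumberField L] [IsCMField L] (H' : Matrix (Fin 3) (Fin 3) L)
  {v : HeightOneSpectrum (𝓞 ↥(maximalRealSubfield L))}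

/-! ## §1 The frame from an integral similitude `ᵗσ̄T Φ₃ T = a · H′_w` -/

/-- **THE FRAME FROM AN INTEGRAL SIMILITUDE (non-split place, ramified allowed).**  `v` a finite place of `L⁺` non-split in `L` (`c • w = w`), `T ∈ GL₃(𝒪_w)`,
`a ∈ L_w` a unit with `ᵗσ̄_w(T) · Φ₃,w · T = a · H′_w`.  Then there is an isomorphism of topological groups `e : G′_v = U(H′)(L⁺_v) ≃ₜ* U(σ_w, Φ₃)(L_w) ≤ GL₃(L_w)` with
(i) `e g = T g_w T⁻¹` (★ `localNonsplitCongr` then ★ `localNonsplitEquiv`), (ii) `g ∈ K′ = U(H′)(𝒪_v) ⟺ e g ∈ GL₃(𝒪_w)`, (iii) MATCHING IS CONJUGACY: `ι_v(γ_H) ↔ b`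
(★ `IsLocalNormPair`) iff `ι((γ_H)_w)` and `e b` are conjugate in `GL₃(L_w)` — the conclusion of ★ `exists_frame_of_nonsplit` for the given `T`.
[cite: Rogawski1990, §14.2 p. 233; §4.9 p. 54] [cite: Flicker1998UnitaryFL, §2 pp. 77–79] [cite: PlatonovRapinchuk1994, §2.3, §5.1] -/
theorem exists_frame_of_formCongr_smul (w : PlacesOver L v) (hw : IsCMField.complexConj L • w.1 = w.1)
    (T : GL (Fin 3) (w.1.adicCompletion L)) (hT : T ∈ glInt 3 (w.1.adicCompletion L)) {a : w.1.adicCompletion L} (ha : IsUnit a)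
    (h : formCongr (galAdicCompletionMap (L := L) (IsCMField.complexConj L) hw) T
        (placeForm (Matrix.of fun i j : Fin 3 => if i.val + j.val + 1 = 3 then (1 : L) else 0) w.1) = a • placeForm H' w.1) :
    ∃ (e : ↥(UnitaryGroup.«local» L (IsCMField.complexConj L) 3 H' v) ≃ₜ*
        ↥(unitaryGroupOfForm (galAdicCompletionMap (L := L) (IsCMField.complexConj L) hw)
          (placeForm (Matrix.of fun i j : Fin 3 => if i.val + j.val + 1 = 3 then (1 : L) else 0) w.1))),
      (∀ g, ((e g).val : GL (Fin 3) (w.1.adicCompletion L)) =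
        T * ((localNonsplitEquiv (IsCMField.complexConj L) H' (IsCMField.complexConj_ne_one L) w hw g).val :
          GL (Fin 3) (w.1.adicCompletion L)) * T⁻¹) ∧
      (∀ g, g ∈ cmLocalIntegralLevel L 3 H' v ↔ ((e g).val : GL (Fin 3) (w.1.adicCompletion L)) ∈ glInt 3 (w.1.adicCompletion L)) ∧
      (∀ γH b, IsLocalNormPair L H' v γH b ↔
        IsConj
          (endoGL
            (((localNonsplitEquiv (IsCMField.complexConj L)
                (Matrix.of fun i j : Fin 2 => if i.val + j.val + 1 = 2 then (1 : L) else 0) (IsCMField.complexConj_ne_one L) w hw γH.1).val :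
                GL (Fin 2) (w.1.adicCompletion L)),
              ((localNonsplitEquiv (IsCMField.complexConj L)
                (Matrix.of fun i j : Fin 1 => if i.val + j.val + 1 = 1 then (1 : L) else 0) (IsCMField.complexConj_ne_one L) w hw γH.2).val :
                GL (Fin 1) (w.1.adicCompletion L))))
          ((e b).val : GL (Fin 3) (w.1.adicCompletion L))) := by
  have hc := IsCMField.complexConj_ne_one L
  -- `ψ : U(H′)(L⁺_v) ≃ₜ* U(Φ₃)(L⁺_v)`, `(ψ g)_w = T g_w T⁻¹`; the frame is `e := (one-place model of U(Φ₃)) ∘ ψ`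
  -- (the composite is unfolded by the LEMMA `trans_apply`, never by kernel δ-reduction of `localNonsplitCongr`)
  refine ⟨(localNonsplitCongr (IsCMField.complexConj L) hc w hw T ha h).trans
    (localNonsplitEquiv (IsCMField.complexConj L) (Matrix.of fun i j : Fin 3 => if i.val + j.val + 1 = 3 then (1 : L) else 0) hc w hw), ?_⟩
  have hform : ∀ g, ((((localNonsplitCongr (IsCMField.complexConj L) hc w hw T ha h).trans
      (localNonsplitEquiv (IsCMField.complexConj L) (Matrix.of fun i j : Fin 3 => if i.val + j.val + 1 = 3 then (1 : L) else 0) hc w hw)) g).val :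
        GL (Fin 3) (w.1.adicCompletion L)) =
      T * ((localNonsplitEquiv (IsCMField.complexConj L) H' hc w hw g).val : GL (Fin 3) (w.1.adicCompletion L)) * T⁻¹ :=
    fun g => (congrArg (fun x : ↥(unitaryGroupOfForm (galAdicCompletionMap (L := L) (IsCMField.complexConj L) hw)
        (placeForm (Matrix.of fun i j : Fin 3 => if i.val + j.val + 1 = 3 then (1 : L) else 0) w.1)) =>
          (x.val : GL (Fin 3) (w.1.adicCompletion L))) (ContinuousMulEquiv.trans_apply _ _ g)).trans
      (localNonsplitEquiv_localNonsplitCongr (IsCMField.complexConj L) hc w hw T ha h g)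
  exact ⟨hform, fun g => (hform g).symm ▸ mem_cmLocalIntegralLevel_iff_conj_mem_glInt L H' w hw hT g,
    fun γH b => (hform b).symm ▸ isLocalNormPair_iff_isConj_endoGL_conj L H' w hw T γH b⟩

/-! ## §2 The frame from the «S3-ram» fold's socket binders `(hH′w) (A hA hframe)` -/

/-- **THE FRAME FROM A SCALED INTEGRAL FRAME `H′_w = (−det H′_w) · ᵗσ̄A Φ₃ A`** — the «S3-ram» fold's ∕ the «P-1-ram» skeleton's socket binders VERBATIM
(`hH′w : IsUnit H′_w`, `A ∈ GL₃(𝒪_w)`, `hframe`; at a tame-ramified `w` they are supplied by ★ `exists_glInt_placeForm_eq_smul_formCongr_antidiagonal_of_neg`): there is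
`e : G′_v ≃ₜ* U(σ_w, Φ₃)(L_w)` with (i) `e g = A g_w A⁻¹`, (ii) `g ∈ K′ ⟺ e g ∈ GL₃(𝒪_w)`, (iii) `ι_v(γ_H) ↔ b ⟺ ι((γ_H)_w) ∼ e b` in `GL₃(L_w)`.  (§1 with `T := A`,
`a := (−det H′_w)⁻¹`, a unit since `H′_w` is.)  No «unramified», no «good reduction»: valid at every non-split place.
[cite: Rogawski1990, §14.2 p. 233; §4.9 p. 54] [cite: Flicker1998UnitaryFL, §2 pp. 77–79] [cite: Jacobowitz1962, §7] [cite: PlatonovRapinchuk1994, §2.3, §5.1] -/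
theorem exists_frame_of_eq_smul_formCongr_antidiagonal (w : PlacesOver L v) (hw : IsCMField.complexConj L • w.1 = w.1)
    (hH'w : IsUnit (placeForm H' w.1))
    (A : GL (Fin 3) (w.1.adicCompletion L)) (hA : A ∈ glInt 3 (w.1.adicCompletion L))
    (hframe : placeForm H' w.1 = (-(placeForm H' w.1).det) •
      formCongr (galAdicCompletionMap (L := L) (IsCMField.complexConj L) hw) A ((StdForm.antidiagonal 3).over (w.1.adicCompletion L))) :
    ∃ (e : ↥(UnitaryGroup.«local» L (IsCMField.complexConj L) 3 H' v) ≃ₜ*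
        ↥(unitaryGroupOfForm (galAdicCompletionMap (L := L) (IsCMField.complexConj L) hw)
          (placeForm (Matrix.of fun i j : Fin 3 => if i.val + j.val + 1 = 3 then (1 : L) else 0) w.1))),
      (∀ g, ((e g).val : GL (Fin 3) (w.1.adicCompletion L)) =
        A * ((localNonsplitEquiv (IsCMField.complexConj L) H' (IsCMField.complexConj_ne_one L) w hw g).val :
          GL (Fin 3) (w.1.adicCompletion L)) * A⁻¹) ∧
      (∀ g, g ∈ cmLocalIntegralLevel L 3 H' v ↔ ((e g).val : GL (Fin 3) (w.1.adicCompletion L)) ∈ glInt 3 (w.1.adicCompletion L)) ∧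
      (∀ γH b, IsLocalNormPair L H' v γH b ↔
        IsConj
          (endoGL
            (((localNonsplitEquiv (IsCMField.complexConj L)
                (Matrix.of fun i j : Fin 2 => if i.val + j.val + 1 = 2 then (1 : L) else 0) (IsCMField.complexConj_ne_one L) w hw γH.1).val :
                GL (Fin 2) (w.1.adicCompletion L)),
              ((localNonsplitEquiv (IsCMField.complexConj L)
                (Matrix.of fun i j : Fin 1 => if i.val + j.val + 1 = 1 then (1 : L) else 0) (IsCMField.complexConj_ne_one L) w hw γH.2).val :
                GL (Fin 1) (w.1.adicCompletion L))))
          ((e b).val : GL (Fin 3) (w.1.adicCompletion L))) := by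
  -- `det H′_w ≠ 0`, so `a := (−det H′_w)⁻¹` is a unit and `ᵗσ̄A Φ₃ A = a · H′_w`
  have hdet : (placeForm H' w.1).det ≠ 0 := ((Matrix.isUnit_iff_isUnit_det _).1 hH'w).ne_zero
  have hneg : -(placeForm H' w.1).det ≠ 0 := neg_ne_zero.2 hdet
  refine exists_frame_of_formCongr_smul L H' w hw A hA (a := (-(placeForm H' w.1).det)⁻¹) (isUnit_iff_ne_zero.2 (inv_ne_zero hneg)) ?_
  rw [placeForm_antidiagOne, eq_inv_smul_iff₀ hneg]
  exact hframe.symm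

end Literature.NumberTheory.Rogawski1990

end
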